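import Mathlib
import Literature.Dynamics.Hamiltonian.KaloshinZhang2018.DominantHamiltonians

/-!
# Kaloshin–Zhang 2018, §1: adapted bases EXIST for an irreducible strong sublattice (kernel-checked)

CITATION HEADER (lean-in-tree rule 2026-08-18). Source: V. Kaloshin, K. Zhang, *Dynamics of the dominant
Hamiltonian*, Bull. Soc. Math. France **146** (2018) 517–574, doi:10.24033/bsmf.2765 (bib key `KaloshinZhang2018`,
REFEREED), read in arXiv:1410.1844v2 (`dominant-arxiv-v2.tex`, locators `l.NNN`). Written by the pub-arnold
near-miss cell (claim row C33) on top of `KaloshinZhang2018.DominantHamiltonians`, which types resonance lattices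
`Λ ≤ ℤⁿ⁺¹`, irreducibility (saturation form), ordered bases and ADAPTED bases `𝓑 = [𝓑ˢᵗ, 𝓑ʷᵏ]`.

WHAT IS REPRODUCED. The sentence used silently throughout §§1–2 and in the quantifier shape of Theorem 2.1
(l.600–613: "integer vectors 𝓑ʷᵏ = [k₁ʷᵏ, ⋯, k_{d−m}ʷᵏ] with [𝓑ˢᵗ, 𝓑ʷᵏ] forming an adapted basis"), namely
l.390–391, verbatim: "Given the relation Λ^st ⊂ Λ, one can choose an *adapted basis* 𝓑 = [k₁, ⋯, k_d] of Λ,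
meaning that 𝓑ˢᵗ = [k₁, ⋯, k_m] is a properly ordered basis of Λˢᵗ" (the standing context is l.383: "We say
that the resonance lattice Λ admits a dominant structure if it contains an irreducible lattice Λ^st of rank
m < d, such that [M(Λ|Λ^st) ≫ max_{k ∈ 𝓑^st} |k|]"). QUOTATION CORRECTION 2026-08-18 (cell GAPS 18:45Z item 5,
DIVERGENCE L15 (iv)): the first accepted version of this docstring quoted the sentence with a prefix "If such
Λˢᵗ exists," and the locator l.391–393; that prefix does not occur in the source — the hypotheses it
paraphrased (a sublattice Λ^st ≤ Λ, irreducible) are l.383 + l.390, which is what `IsSublattice` + `Irreducible`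
below assume. The algebraic content is: an irreducible (= saturated)
sublattice of a finitely generated free abelian group is a direct summand, so EVERY ordered basis of `Λˢᵗ` extends
to an ordered basis of `Λ`, with exactly `rank Λ − rank Λˢᵗ` new ("weak") vectors. We prove it from Mathlib's Smith
normal form over a PID (`Submodule.exists_smith_normal_form_of_le`): the invariant factors `aᵢ` of `Λˢᵗ ≤ Λ` are
non-zero, saturation forces the corresponding basis vectors of `Λ` into `Λˢᵗ`, the remaining basis vectors of
`Λ` are the weak vectors, and linear independence of `[𝓑ˢᵗ, 𝓑ʷᵏ]` follows from "a spanning family of `rank Λ`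
vectors in a free `ℤ`-module of that rank is a basis" (`linearIndependent_iff_card_eq_finrank_span`, Orzech
property of `ℤ`).

WHAT IS NOT HERE: the number-theoretic half of Theorem 2.1 (the CHOICE of `𝓑ʷᵏ` with `|kᵢʷᵏ| < κ(1 + |kⱼʷᵏ|)` and
the `Cʳ` Fourier-decay estimate of item 2) — analysis, cited only (`Theorem21Shape` in `DominantHamiltonians`).
-/

open Module Submodule

namespace Literature.Dynamics.Hamiltonian.KaloshinZhang2018

variable {n : ℕ}

/-- A basis of a submodule `N ≤ M`, read in `M`, spans exactly `N`. [folklore] -/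
theorem span_range_coe_basis {R M : Type*} [Ring R] [AddCommGroup M] [Module R M] {ι : Type*}
    (N : Submodule R M) (b : Basis ι R N) :
    Submodule.span R (Set.range fun i => (b i : M)) = N := by
  apply le_antisymm
  · exact Submodule.span_le.mpr (by rintro _ ⟨i, rfl⟩; exact (b i).2)
  · intro x hx
    have hmem : (⟨x, hx⟩ : N) ∈ Submodule.span R (Set.range b) := by
      rw [b.span_eq]; exact Submodule.mem_top
    have h := Submodule.apply_mem_span_image_of_mem_span N.subtype hmem
    rw [← Set.range_comp] at h
    simpa [Function.comp_def] using h

namespace ResonanceLattice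

/-- **Adapted bases exist** (l.390–391; the algebraic half of the quantifier shape of Theorem 2.1, l.600–613).
Let `Λˢᵗ ≤ Λ` be resonance lattices with `Λˢᵗ` irreducible, and let `𝓑ˢᵗ = [k₁ˢᵗ, ⋯, k_mˢᵗ]` be ANY ordered basis
of `Λˢᵗ`. Then there are `w` integer vectors `𝓑ʷᵏ = [k₁ʷᵏ, ⋯, k_wʷᵏ]` such that `[𝓑ˢᵗ, 𝓑ʷᵏ]` is an adapted basis
of `Λ`; necessarily `m = rank Λˢᵗ` and `m + w = rank Λ` (so `w = d − m` in the paper's notation). Proof: Smith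
normal form of `Λˢᵗ ≤ Λ ≤ ℤⁿ⁺¹` over the PID `ℤ` + saturation + the Orzech property of `ℤ`.
[cite: KaloshinZhang2018, §1 l.390–391] -/
theorem exists_isAdaptedBasis (Λst Λ : ResonanceLattice n) (hle : IsSublattice Λst Λ)
    (hirr : Irreducible Λst) {m : ℕ} {𝓑st : Fin m → IntVec n} (h𝓑 : IsOrderedBasis Λst 𝓑st) :
    ∃ (w : ℕ) (𝓑wk : Fin w → IntVec n),
      IsAdaptedBasis Λst Λ 𝓑st 𝓑wk ∧ m = rank Λst ∧ m + w = rank Λ := by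
  classical
  obtain ⟨nS, o, hno, bO, bN, a, hsnf⟩ :=
    Submodule.exists_smith_normal_form_of_le (Pi.basisFun ℤ (Fin (n + 1))) Λst.carrier Λ.carrier hle
  -- (0) read the Smith relation in `ℤⁿ⁺¹`
  have hsnf' : ∀ i, (bN i : IntVec n) = a i • (bO (Fin.castLE hno i) : IntVec n) := by
    intro i
    rw [hsnf i]
  -- (1) the invariant factors are non-zero
  have ha : ∀ i, a i ≠ 0 := by
    intro i hai
    have h0 : (bN i : IntVec n) = 0 := by rw [hsnf' i, hai, zero_smul]
    exact bN.ne_zero i ((Submodule.coe_eq_zero).1 h0)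
  -- (2) saturation: the `Λ`-basis vectors underneath the `Λˢᵗ`-basis lie in `Λˢᵗ`
  have hmemSt : ∀ i : Fin nS, (bO (Fin.castLE hno i) : IntVec n) ∈ Λst.carrier := fun i =>
    hirr _ (a i) (ha i) (by rw [← hsnf' i]; exact (bN i).2)
  -- (3) the two lattices as spans in `ℤⁿ⁺¹`
  have hO : Submodule.span ℤ (Set.range fun j => (bO j : IntVec n)) = Λ.carrier :=
    span_range_coe_basis _ bO
  -- (4) ranks
  have hrankΛ : rank Λ = o := by
    simp [rank, Module.finrank_eq_card_basis bO]
  have hrankSt : rank Λst = nS := by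
    simp [rank, Module.finrank_eq_card_basis bN]
  have hm : m = nS := by
    have h := finrank_span_eq_card (R := ℤ) h𝓑.linearIndependent
    rw [h𝓑.span_eq, Fintype.card_fin] at h
    rw [← hrankSt]
    exact h.symm
  -- (5) the weak vectors = the remaining vectors of the `Λ`-basis
  set w := o - nS with hw
  let 𝓑wk : Fin w → IntVec n := fun j => (bO ⟨nS + (j : ℕ), by omega⟩ : IntVec n)
  -- (6) `[𝓑ˢᵗ, 𝓑ʷᵏ]` spans `Λ`
  have hspan : Submodule.span ℤ (Set.range (Fin.append 𝓑st 𝓑wk)) = Λ.carrier := by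
    apply le_antisymm
    · refine Submodule.span_le.mpr ?_
      rintro _ ⟨i, rfl⟩
      induction i using Fin.addCases with
      | left i => rw [Fin.append_left]; exact hle (h𝓑.mem i)
      | right j => rw [Fin.append_right]; exact (bO _).2
    · rw [← hO]
      refine Submodule.span_le.mpr ?_
      rintro _ ⟨j, rfl⟩
      dsimp only
      by_cases hj : (j : ℕ) < nS
      · -- a vector under the strong basis: in `Λˢᵗ = span 𝓑ˢᵗ ≤ span [𝓑ˢᵗ, 𝓑ʷᵏ]`
        have hj' : j = Fin.castLE hno ⟨j, hj⟩ := Fin.ext (by simp)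
        have hmem : (bO j : IntVec n) ∈ Λst.carrier := by rw [hj']; exact hmemSt ⟨j, hj⟩
        rw [← h𝓑.span_eq] at hmem
        refine Submodule.span_mono ?_ hmem
        rintro _ ⟨i, rfl⟩
        exact ⟨Fin.castAdd w i, Fin.append_left 𝓑st 𝓑wk i⟩
      · -- a weak vector
        push Not at hj
        have hjw : (j : ℕ) - nS < w := by omega
        have hj' : (bO j : IntVec n) = 𝓑wk ⟨(j : ℕ) - nS, hjw⟩ := by
          simp only [𝓑wk]
          congr 2
          exact Fin.ext (by simp; omega)
        rw [hj']
        exact Submodule.subset_span ⟨Fin.natAdd m ⟨(j : ℕ) - nS, hjw⟩, Fin.append_right 𝓑st 𝓑wk _⟩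
  -- (7) and is linearly independent, by counting (Orzech property of `ℤ`)
  have hli : LinearIndependent ℤ (Fin.append 𝓑st 𝓑wk) := by
    rw [linearIndependent_iff_card_eq_finrank_span]
    show Fintype.card (Fin (m + w)) = Module.finrank ℤ (Submodule.span ℤ (Set.range (Fin.append 𝓑st 𝓑wk)))
    rw [hspan, Fintype.card_fin]
    change m + w = rank Λ
    omega
  exact ⟨w, 𝓑wk, ⟨h𝓑, ⟨hli, hspan⟩⟩, by omega, by omega⟩

/-- Rank monotonicity recorded on the way: an irreducible `Λˢᵗ ≤ Λ` has `rank Λˢᵗ ≤ rank Λ`, with equality of the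
difference to the number of weak vectors of any adapted basis (`exists_isAdaptedBasis`). [folklore] -/
theorem rank_le_rank_of_isSublattice (Λst Λ : ResonanceLattice n) (hle : IsSublattice Λst Λ)
    (hirr : Irreducible Λst) : rank Λst ≤ rank Λ := by
  classical
  -- any lattice has an ordered basis indexed by `Fin (rank Λˢᵗ)`
  obtain ⟨k, bSt⟩ := Submodule.basisOfPid (Pi.basisFun ℤ (Fin (n + 1))) Λst.carrier
  have hb : IsOrderedBasis Λst (fun i => (bSt i : IntVec n)) :=
    ⟨(bSt.linearIndependent.map' Λst.carrier.subtype (Submodule.ker_subtype _)),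
      span_range_coe_basis _ bSt⟩
  obtain ⟨w, 𝓑wk, -, hm, hmw⟩ := exists_isAdaptedBasis Λst Λ hle hirr hb
  omega

end ResonanceLattice

end Literature.Dynamics.Hamiltonian.KaloshinZhang2018
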